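import Mathlib
import Summits.ValiantsHypothesis.ValiantsHypothesis.Theorems.LacunarySymmetroidMatrixDescartesInertiaIndexFormula

/-!
# `MatrixDescartes` (stmt-ValiantsHypothesis-18050) — INERTIA KIT, IV-d: THE TYPE-RUN LAW — the roots of `det F` counted with
# multiplicity equal the TOTAL VARIATION of the inertia walk sampled between type runs; `R` runs of one-typed roots carry at
# most `R·m` roots, for EVERY real symmetric lacunary pencil at EVERY format

HONEST FRAMING.  Cell `pub-symmetroid`, seat `val-sym-mdr-p2` (gen 17); helper file `--supports` the crux
`Theses.LacunarySymmetroid.MatrixDescartes`, NO closure claim.  General theorem for EVERY real symmetric lacunary pencil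
`F(X) = ∑ₖ X^{dₖ}Sₖ`; the intrinsic form of g16's many-windows engine (`DefiniteMoments.card_roots_le_mul_of_directedWindows`, where a
window is «directed» through one-way propagation of every Rayleigh quotient): here a window only needs its ROOTS to be of one
definite type — first-order data at the kernels, nothing away from the roots — and the count is an EQUALITY.  Nothing here bears on
the crux in its window, on `stub_twoSided`, on `DoorA26`/`DoorA34`, registers, or `VP ≠ VNP`.

CONTENT.  Separators `w₀ < w₁ < ⋯ < w_R`, all non-singular for `F`, such that in each window `(wᵢ, wᵢ₊₁)` the roots of `det F` are
all of negative type or all of positive type (a TYPE RUN; the type may change from window to window).  THE TYPE-RUN LAW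
(`card_roots_eq_sum_dist_of_typeRuns`): the roots of `det F` in `(w₀, w_R)` counted with multiplicity number EXACTLY
`∑ᵢ |ν(F(wᵢ₊₁)) − ν(F(wᵢ))|` — the total variation of the inertia staircase `ν(F(w₀)), …, ν(F(w_R))` — hence at most `R · card ι`
(`card_roots_le_mul_of_typeRuns`), and for the positive roots `Z₊ ≤ R·m` as soon as the separators enclose them
(`card_posRoots_multiset_le_mul_of_typeRuns`).  One run = the ONE-TYPE LAW (`…InertiaOneType`); `K − 1` runs of alternating type =
the hyperbolic sector's exact count; the g16 reading «Z₊ ≤ m · N_dir» becomes «Z₊ = TV(ν) ≤ m · #type-runs».  Tool: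
`card_filter_window_eq_sum` (a multiset avoiding the separators splits its open-window count over the sub-windows).
[folklore]; axioms standard; no definitions.
-/

-- layout Summits/ValiantsHypothesis/ValiantsHypothesis forces the duplicated namespace component
set_option linter.dupNamespace false

namespace Summit.ValiantsHypothesis.ValiantsHypothesis.Theorems.LacunarySymmetroidMatrixDescartes

open Matrix Finset Polynomial
open scoped BigOperators Topology

namespace Inertia

variable {ι : Type} [Fintype ι] [DecidableEq ι]

/-! ## §1 Splitting an open-window count over consecutive sub-windows -/

omit [Fintype ι] [DecidableEq ι] in
/-- A multiset avoiding the separators `w₀ < ⋯ < w_R` splits its count on `(w₀, w_R)` over the windows `(wᵢ, wᵢ₊₁)`. [folklore] -/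
theorem card_filter_window_eq_sum (M : Multiset ℝ) :
    ∀ (R : ℕ) (w : Fin (R + 1) → ℝ), StrictMono w → (∀ i, ∀ t ∈ M, t ≠ w i) →
      Multiset.card (M.filter (fun t => w 0 < t ∧ t < w (Fin.last R)))
        = ∑ i : Fin R, Multiset.card (M.filter (fun t => w i.castSucc < t ∧ t < w i.succ)) := by
  classical
  intro R
  induction R with
  | zero =>
    intro w _ _
    rw [Finset.univ_eq_empty, Finset.sum_empty, Multiset.card_eq_zero, Multiset.filter_eq_nil]
    intro t _ h
    exact lt_irrefl _ (lt_trans h.1 (by simpa using h.2))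
  | succ R ih =>
    intro w hw hM
    -- split `(w₀, w_{R+1})` at the non-member `w_R`
    have hsplit := Multiset.filter_add_not (fun t => t < w (Fin.last R).castSucc)
      (M.filter (fun t => w 0 < t ∧ t < w (Fin.last (R + 1))))
    rw [Multiset.filter_filter, Multiset.filter_filter] at hsplit
    have hlt : w (Fin.last R).castSucc < w (Fin.last (R + 1)) := hw (Fin.castSucc_lt_last _)
    have h1 : M.filter (fun t => t < w (Fin.last R).castSucc ∧ (w 0 < t ∧ t < w (Fin.last (R + 1))))
        = M.filter (fun t => (w ∘ Fin.castSucc) 0 < t ∧ t < (w ∘ Fin.castSucc) (Fin.last R)) := by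
      refine Multiset.filter_congr fun t _ => ?_
      simp only [Function.comp_apply, Fin.castSucc_zero]
      constructor
      · rintro ⟨h1, h2, -⟩; exact ⟨h2, h1⟩
      · rintro ⟨h1, h2⟩; exact ⟨h2, h1, lt_trans h2 hlt⟩
    have h2 : M.filter (fun t => ¬ t < w (Fin.last R).castSucc ∧ (w 0 < t ∧ t < w (Fin.last (R + 1))))
        = M.filter (fun t => w (Fin.last R).castSucc < t ∧ t < w (Fin.last R).succ) := by
      refine Multiset.filter_congr fun t ht => ?_
      rw [Fin.succ_last]
      constructor
      · rintro ⟨h1, -, h3⟩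
        exact ⟨lt_of_le_of_ne (not_lt.1 h1) (fun h => hM _ t ht h.symm), h3⟩
      · rintro ⟨h1, h3⟩
        exact ⟨not_lt.2 h1.le, lt_of_le_of_lt (hw.monotone (Fin.zero_le _)) h1, h3⟩
    rw [h1, h2] at hsplit
    rw [← hsplit, Multiset.card_add, Fin.sum_univ_castSucc,
      ih (w ∘ Fin.castSucc) (hw.comp Fin.strictMono_castSucc) (fun i t ht => hM _ t ht)]
    simp only [Function.comp_apply, Fin.succ_castSucc]

/-! ## §2 The type-run law -/

section Pencil

variable {κ : Type} [Fintype κ]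

/-- **THE TYPE-RUN LAW.**  `F(X) = ∑ₖ X^{dₖ}Sₖ` real symmetric; separators `w₀ < ⋯ < w_R` non-singular for `F`, each window
`(wᵢ, wᵢ₊₁)` carrying roots of `det F` of ONE definite type (all negative type, or all positive type).  Then the roots of `det F`
in `(w₀, w_R)` counted with multiplicity number EXACTLY `∑ᵢ |ν(F(wᵢ₊₁)) − ν(F(wᵢ))|`, the total variation of the inertia walk
sampled at the separators. [folklore] -/
theorem card_roots_eq_sum_dist_of_typeRuns (d : κ → ℕ) (S : κ → Matrix ι ι ℝ) (hS : ∀ k, (S k).IsSymm)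
    (R : ℕ) (w : Fin (R + 1) → ℝ) (hw : StrictMono w) (hns : ∀ i, (∑ k, w i ^ d k • S k).det ≠ 0)
    (hruns : ∀ i : Fin R,
      (∀ t, w i.castSucc < t → t < w i.succ → (∑ k, t ^ d k • S k).det = 0 → ∀ u : ι → ℝ,
        (∑ k, t ^ d k • S k) *ᵥ u = 0 → u ≠ 0 →
          (derivative (∑ k, C (u ⬝ᵥ (S k *ᵥ u)) * (X : ℝ[X]) ^ d k)).eval t < 0) ∨
      (∀ t, w i.castSucc < t → t < w i.succ → (∑ k, t ^ d k • S k).det = 0 → ∀ u : ι → ℝ,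
        (∑ k, t ^ d k • S k) *ᵥ u = 0 → u ≠ 0 →
          0 < (derivative (∑ k, C (u ⬝ᵥ (S k *ᵥ u)) * (X : ℝ[X]) ^ d k)).eval t)) :
    Multiset.card ((Matrix.det (∑ k, ((X : ℝ[X]) ^ d k) • (S k).map C)).roots.filter
        (fun t => w 0 < t ∧ t < w (Fin.last R)))
      = ∑ i : Fin R, Nat.dist (Fintype.card {j // (isHermitian_pencil d S hS (w i.castSucc)).eigenvalues j < 0})
          (Fintype.card {j // (isHermitian_pencil d S hS (w i.succ)).eigenvalues j < 0}) := by
  classical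
  set P := Matrix.det (∑ k, ((X : ℝ[X]) ^ d k) • (S k).map C) with hP
  have hdet : P ≠ 0 := det_pencil_ne_zero_of_eval d S (hns 0)
  have hM : ∀ i, ∀ t ∈ P.roots, t ≠ w i := by
    intro i t ht h
    have hr := (mem_roots hdet).1 ht
    rw [IsRoot, DefiniteMoments.eval_det_pencil, h] at hr
    exact hns i hr
  rw [card_filter_window_eq_sum P.roots R w hw hM]
  refine Finset.sum_congr rfl fun i _ => ?_
  have hlt : w i.castSucc < w i.succ := hw Fin.castSucc_lt_succ
  rcases hruns i with h | h
  · have h1 := (card_roots_Ioo_add_negIndex_eq_of_negType d S hS hlt (hns _) (hns _) h).1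
    rw [← hP] at h1
    simp only [Nat.dist]
    omega
  · have h1 := (card_roots_Ioo_add_negIndex_eq_of_posType d S hS hlt (hns _) (hns _) h).1
    rw [← hP] at h1
    simp only [Nat.dist]
    omega

/-- **`R` type runs carry at most `R · card ι` roots with multiplicity.** [folklore] -/
theorem card_roots_le_mul_of_typeRuns (d : κ → ℕ) (S : κ → Matrix ι ι ℝ) (hS : ∀ k, (S k).IsSymm)
    (R : ℕ) (w : Fin (R + 1) → ℝ) (hw : StrictMono w) (hns : ∀ i, (∑ k, w i ^ d k • S k).det ≠ 0)
    (hruns : ∀ i : Fin R,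
      (∀ t, w i.castSucc < t → t < w i.succ → (∑ k, t ^ d k • S k).det = 0 → ∀ u : ι → ℝ,
        (∑ k, t ^ d k • S k) *ᵥ u = 0 → u ≠ 0 →
          (derivative (∑ k, C (u ⬝ᵥ (S k *ᵥ u)) * (X : ℝ[X]) ^ d k)).eval t < 0) ∨
      (∀ t, w i.castSucc < t → t < w i.succ → (∑ k, t ^ d k • S k).det = 0 → ∀ u : ι → ℝ,
        (∑ k, t ^ d k • S k) *ᵥ u = 0 → u ≠ 0 →
          0 < (derivative (∑ k, C (u ⬝ᵥ (S k *ᵥ u)) * (X : ℝ[X]) ^ d k)).eval t)) :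
    Multiset.card ((Matrix.det (∑ k, ((X : ℝ[X]) ^ d k) • (S k).map C)).roots.filter
        (fun t => w 0 < t ∧ t < w (Fin.last R))) ≤ R * Fintype.card ι := by
  rw [card_roots_eq_sum_dist_of_typeRuns d S hS R w hw hns hruns]
  have hle : ∀ i ∈ (Finset.univ : Finset (Fin R)),
      Nat.dist (Fintype.card {j // (isHermitian_pencil d S hS (w i.castSucc)).eigenvalues j < 0})
        (Fintype.card {j // (isHermitian_pencil d S hS (w i.succ)).eigenvalues j < 0}) ≤ Fintype.card ι := by
    intro i _
    have h1 : Fintype.card {j // (isHermitian_pencil d S hS (w i.castSucc)).eigenvalues j < 0} ≤ Fintype.card ι :=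
      Fintype.card_subtype_le _
    have h2 : Fintype.card {j // (isHermitian_pencil d S hS (w i.succ)).eigenvalues j < 0} ≤ Fintype.card ι :=
      Fintype.card_subtype_le _
    simp only [Nat.dist]
    omega
  refine le_trans (Finset.sum_le_sum hle) ?_
  rw [Finset.sum_const, Finset.card_univ, Fintype.card_fin, smul_eq_mul]

/-- **THE TYPE-RUN LAW for positive roots: `Z₊ ≤ R · card ι` with multiplicity.**  If separators `0 < w₀ < ⋯ < w_R`, non-singular
for `F`, enclose every positive root of `det F` (`det F(t) = 0`, `t > 0` ⇒ `w₀ < t < w_R`) and every window `(wᵢ, wᵢ₊₁)` is a type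
run, then the positive roots of `det F` counted with multiplicity number at most `R · card ι`. [folklore] -/
theorem card_posRoots_multiset_le_mul_of_typeRuns (d : κ → ℕ) (S : κ → Matrix ι ι ℝ) (hS : ∀ k, (S k).IsSymm)
    (R : ℕ) (w : Fin (R + 1) → ℝ) (hw : StrictMono w) (hw0 : 0 < w 0) (hns : ∀ i, (∑ k, w i ^ d k • S k).det ≠ 0)
    (henc : ∀ t, 0 < t → (∑ k, t ^ d k • S k).det = 0 → w 0 < t ∧ t < w (Fin.last R))
    (hruns : ∀ i : Fin R,
      (∀ t, w i.castSucc < t → t < w i.succ → (∑ k, t ^ d k • S k).det = 0 → ∀ u : ι → ℝ,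
        (∑ k, t ^ d k • S k) *ᵥ u = 0 → u ≠ 0 →
          (derivative (∑ k, C (u ⬝ᵥ (S k *ᵥ u)) * (X : ℝ[X]) ^ d k)).eval t < 0) ∨
      (∀ t, w i.castSucc < t → t < w i.succ → (∑ k, t ^ d k • S k).det = 0 → ∀ u : ι → ℝ,
        (∑ k, t ^ d k • S k) *ᵥ u = 0 → u ≠ 0 →
          0 < (derivative (∑ k, C (u ⬝ᵥ (S k *ᵥ u)) * (X : ℝ[X]) ^ d k)).eval t)) :
    Multiset.card ((Matrix.det (∑ k, ((X : ℝ[X]) ^ d k) • (S k).map C)).roots.filter (fun t => 0 < t))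
      ≤ R * Fintype.card ι := by
  set P := Matrix.det (∑ k, ((X : ℝ[X]) ^ d k) • (S k).map C) with hP
  have hdet : P ≠ 0 := det_pencil_ne_zero_of_eval d S (hns 0)
  have hfilt : P.roots.filter (fun t => 0 < t) = P.roots.filter (fun t => w 0 < t ∧ t < w (Fin.last R)) := by
    refine Multiset.filter_congr fun t ht => ⟨fun hpt => ?_, fun h => lt_trans hw0 h.1⟩
    have hdt : (∑ k, t ^ d k • S k).det = 0 := by
      have h := (mem_roots hdet).1 ht
      rwa [IsRoot, DefiniteMoments.eval_det_pencil] at h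
    exact henc t hpt hdt
  rw [hfilt]
  exact card_roots_le_mul_of_typeRuns d S hS R w hw hns hruns

end Pencil

end Inertia

end Summit.ValiantsHypothesis.ValiantsHypothesis.Theorems.LacunarySymmetroidMatrixDescartes
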